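import Mathlib
import Summits.NavierStokesRegularity.NavierStokesRegularity.Theses.UnthreadedDoor

/-!
# Crux idea «typei-farpast-collapse» (planner ns-idea-14 g0, lens «strengthen», wall W1 =
# crux stmt-NavierStokesRegularity-1222 `PoloidalLiouville`, registered wall stub `stub_scalarLiouville`)

Typed sketch.  Nothing here proves `PoloidalLiouville`, the UnthreadedDoor target beyond what the tree
already has, or Navier–Stokes regularity (OPEN).  Contents:

* `PoloidalLiouvilleTypeI` — C⁻, the Type-I-in-time sub-statement of the crux that route UnthreadedDoor
  actually instantiates (its `closes` feeds a time-shifted `HasTypeITimeDecay` profile);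
* `closes_typeI` — KERNEL-CHECKED: UnthreadedDoor's deciding theorem goes through verbatim with C⁻ in
  place of the crux (the shift keeps the Type-I constant, `hasTypeITimeDecay_shift`);
* `collapse_of_antitoneOn` — the far-past collapse lemma (real variable);
* `typeI_of_functional` — PROVED schema: any functional Ψ on the Type-I unthreaded class that is
  (MP) forward sup-monotone, (D) far-past decaying, (N) nonnegative and (Det) detecting closes C⁻;
  the research content of the wall in the consumed class is (MP) alone;
* `PlanarUnthreadedLiouville` — the extra statement the crux AS TYPED (bounded class) meets when
  near-maximisers escape to spatial infinity (recorded, not claimed).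
-/

open Set Filter Topology MeasureTheory
open scoped RealInnerProductSpace

set_option linter.dupNamespace false

namespace Summit.NavierStokesRegularity.NavierStokesRegularity.Cruxes.PoloidalLiouville.FarPastCollapse

open Summit.NavierStokesRegularity.NavierStokesRegularity.Theses
open Literature.Analysis.FluidPDE

local notation "E3" => EuclideanSpace ℝ (Fin 3)

/-- The TYPE-I UNTHREADED CLASS: the hypotheses of `PoloidalLiouville` plus Type-I decay in time
`‖v(t,x)‖ ≤ C/√(−t)` — exactly what `UnthreadedDoor.closes` hands to the crux. -/
def IsTypeIUnthreaded (v : ℝ → E3 → E3) : Prop :=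
  (∃ C : ℝ, HasTypeITimeDecay C v) ∧ IsBoundedAncientMildSolution 1 v ∧
    (∀ t < 0, AEStronglyMeasurable (v t) volume) ∧
    ContDiffOn ℝ (⊤ : ℕ∞) (Function.uncurry v) (Set.Iio 0 ×ˢ Set.univ) ∧
    ∃ x₀ : E3, ∀ t < 0, ∀ x, inner ℝ (x - x₀) (curl (v t) x) = 0

/-- C⁻ = `PoloidalLiouvilleTypeI`: the crux restricted to Type-I-in-time profiles. -/
def PoloidalLiouvilleTypeI : Prop :=
  ∀ v : ℝ → E3 → E3, IsTypeIUnthreaded v → ∀ t < 0, ∃ b : E3, ∀ x, v t x = b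

/-- The crux implies C⁻ (C⁻ is a sub-statement, recorded for orientation). -/
theorem typeI_of_poloidalLiouville (h : UnthreadedDoor.PoloidalLiouville) : PoloidalLiouvilleTypeI :=
  fun v hv => h v hv.2.1 hv.2.2.1 hv.2.2.2.1 hv.2.2.2.2

/-- A Type-I constant is nonnegative. -/
theorem typeI_const_nonneg {C : ℝ} {v : ℝ → E3 → E3} (h : HasTypeITimeDecay C v) : 0 ≤ C := by
  have h1 := h (-1) (by norm_num) 0
  rw [neg_neg, Real.sqrt_one, div_one] at h1
  exact (norm_nonneg _).trans h1

/-- A backward time shift `t ↦ t − δ`, `0 < δ`, keeps Type-I-in-time decay with the SAME constant. -/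
theorem hasTypeITimeDecay_shift {C : ℝ} {v : ℝ → E3 → E3} (h : HasTypeITimeDecay C v) {δ : ℝ}
    (hδ : 0 < δ) : HasTypeITimeDecay C (fun t x => v (t - δ) x) := by
  intro t ht x
  refine (h (t - δ) (by linarith) x).trans ?_
  exact div_le_div_of_nonneg_left (typeI_const_nonneg h) (Real.sqrt_pos.2 (by linarith))
    (Real.sqrt_le_sqrt (by linarith))

/-- KERNEL CHECK OF THE RE-TYPING: route UnthreadedDoor's deciding theorem with C⁻ in place of the
crux (same proof as the gate-written `UnthreadedDoor.closes`, plus the shifted Type-I constant). -/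
theorem closes_typeI (hZ : UnthreadedDoor.UnthreadedZoom) (hS : UnthreadedDoor.ShiftedPoloidalClass)
    (hP : PoloidalLiouvilleTypeI) (hE : UnthreadedDoor.ConstantSliceExtinction) :
    UnthreadedDoor.Target := by
  intro ν T hν hT u p hcl hLH hdec x₀ ρ M hρ hwin hfade
  by_contra hbb
  obtain ⟨C, v, ⟨hdecay, hcont, hmild, hdiv⟩, hsing, htor⟩ :=
    hZ ν T hν hT u p hcl hLH hdec x₀ ρ M hρ hwin hfade hbb
  refine hE C v hdecay hcont hmild hdiv ?_ hsing
  intro t ht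
  have hδ : 0 < -t / 2 := by linarith
  obtain ⟨h1, h2, h3, h4⟩ := hS C v hdecay hcont hmild hdiv htor (-t / 2) hδ
  obtain ⟨b, hb⟩ := hP (fun s x => v (s - -t / 2) x)
    ⟨⟨C, hasTypeITimeDecay_shift hdecay hδ⟩, h1, h2, h3, ⟨0, h4⟩⟩ (t / 2) (by linarith)
  refine ⟨b, fun x => ?_⟩
  have hx := hb x
  have ht' : t / 2 - -t / 2 = t := by ring
  simp only [ht'] at hx
  exact hx

/-- FAR-PAST COLLAPSE (real variable): a function on `(−∞,0)` that is non-increasing forward in time,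
nonnegative, and tends to `0` in the far past vanishes identically. -/
theorem collapse_of_antitoneOn {Φ : ℝ → ℝ} (hanti : AntitoneOn Φ (Set.Iio 0))
    (hlim : Tendsto Φ atBot (𝓝 0)) (hnn : ∀ t < 0, 0 ≤ Φ t) : ∀ t < 0, Φ t = 0 := by
  intro t ht
  refine le_antisymm (ge_of_tendsto hlim ?_) (hnn t ht)
  filter_upwards [eventually_le_atBot t] with s hs
  exact hanti (Set.mem_Iio.2 (lt_of_le_of_lt hs ht)) (Set.mem_Iio.2 ht) hs

/-- (MP) forward sup-monotonicity of a functional on the Type-I unthreaded class. -/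
def SupMonotone (Ψ : (ℝ → E3 → E3) → ℝ → ℝ) : Prop :=
  ∀ v, IsTypeIUnthreaded v → AntitoneOn (Ψ v) (Set.Iio 0)

/-- (D) far-past decay (for scale-covariant functionals bounded by derivative norms this is the
Type-I smoothing bound `‖∇ᵏv(s)‖∞ ≤ C_k (−s)^{−(1+k)/2}`). -/
def FarPastDecay (Ψ : (ℝ → E3 → E3) → ℝ → ℝ) : Prop :=
  ∀ v, IsTypeIUnthreaded v → Tendsto (Ψ v) atBot (𝓝 0)

/-- (N) one-signedness. -/
def Nonneg (Ψ : (ℝ → E3 → E3) → ℝ → ℝ) : Prop :=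
  ∀ v, IsTypeIUnthreaded v → ∀ t < 0, 0 ≤ Ψ v t

/-- (Det) detection: Ψ ≡ 0 forces spatially constant slices. -/
def Detects (Ψ : (ℝ → E3 → E3) → ℝ → ℝ) : Prop :=
  ∀ v, IsTypeIUnthreaded v → (∀ t < 0, Ψ v t = 0) → ∀ t < 0, ∃ b : E3, ∀ x, v t x = b

/-- PROVED SCHEMA: one functional with (MP), (D), (N), (Det) closes C⁻ — no Harnack / half-ball
step (KNSS Lemma 2.1), no decay weight, no oscillation decay. -/
theorem typeI_of_functional (Ψ : (ℝ → E3 → E3) → ℝ → ℝ) (hMP : SupMonotone Ψ)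
    (hD : FarPastDecay Ψ) (hN : Nonneg Ψ) (hDet : Detects Ψ) : PoloidalLiouvilleTypeI :=
  fun v hv => hDet v hv (collapse_of_antitoneOn (hMP v hv) (hD v hv) (hN v hv))

/-- Recorded, NOT claimed: the planar-unthreaded bounded-ancient Liouville statement that a
compactness proof of the crux AS TYPED (bounded class) meets when near-maximisers of Ψ escape to
spatial infinity relative to the centre (spheres degenerate to planes ⟂ e). -/
def PlanarUnthreadedLiouville : Prop :=
  ∀ v : ℝ → E3 → E3, IsBoundedAncientMildSolution 1 v →
    (∀ t < 0, AEStronglyMeasurable (v t) volume) →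
    ContDiffOn ℝ (⊤ : ℕ∞) (Function.uncurry v) (Set.Iio 0 ×ˢ Set.univ) →
    (∃ e : E3, e ≠ 0 ∧ ∀ t < 0, ∀ x, inner ℝ e (curl (v t) x) = 0) →
    ∀ t < 0, ∃ b : E3, ∀ x, v t x = b


/-! ### Re-typed wall stub for the registered (2b) line (v2 skeleton of ns-idea-6, stubs copied VERBATIM as Props)

The four companion stub STATEMENTS of the v2 skeleton `PoloidalLiouville_antidynamo_birth_v2.lean` (bridge, (2a),
(2a-evo), stub 3) are reproduced verbatim (that file is not importable); `StubScalarLiouvilleTypeI` is THEIR wall stub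
`StubScalarLiouville` with ONE added hypothesis `∃ C, HasTypeITimeDecay C v`.  `PoloidalLiouvilleTypeI_of_stubs` is the
kernel-checked composition (hypotheses, no sorry): the v2 line with the re-typed wall closes C⁻, hence (by
`closes_typeI`) the door route. -/

/-- v2 bridge stub statement (verbatim copy). -/
def StubVorticityOfClass : Prop :=
  ∀ (v : ℝ → E3 → E3),
    IsBoundedAncientMildSolution 1 v →
    (∀ t < 0, AEStronglyMeasurable (v t) volume) →
    ContDiffOn ℝ (⊤ : ℕ∞) (Function.uncurry v) (Set.Iio 0 ×ˢ Set.univ) →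
    IsVorticitySolutionOn (Set.Iio 0) 1 v ∧ ∃ K : ℝ, ∀ t < 0, ∀ x, ‖curl (v t) x‖ ≤ K

/-- v2 stub (2a) statement (verbatim copy): toroidal potential. -/
def StubToroidalPotential : Prop :=
  ∀ (v : ℝ → E3 → E3) (x₀ : E3) (K : ℝ),
    ContDiffOn ℝ (⊤ : ℕ∞) (Function.uncurry v) (Set.Iio 0 ×ˢ Set.univ) →
    (∀ t < 0, ∀ x, ‖curl (v t) x‖ ≤ K) →
    (∀ t < 0, ∀ x, inner ℝ (x - x₀) (curl (v t) x) = 0) →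
    ∃ T : ℝ → E3 → ℝ,
      ContDiffOn ℝ (⊤ : ℕ∞) (Function.uncurry T) (Set.Iio 0 ×ˢ ({x₀}ᶜ : Set E3)) ∧
      (∀ t < 0, ∀ x, |T t x| ≤ Real.pi * K) ∧
      ∀ t < 0, ∀ x, curl (v t) x = cross (gradient (T t) x) (x - x₀)

/-- v2 stub (2a-evo) statement (verbatim copy): evolution law (E1) of the potential. -/
def StubPotentialEvolution : Prop :=
  ∀ (v : ℝ → E3 → E3) (x₀ : E3) (T : ℝ → E3 → ℝ),
    IsVorticitySolutionOn (Set.Iio 0) 1 v →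
    ContDiffOn ℝ (⊤ : ℕ∞) (Function.uncurry T) (Set.Iio 0 ×ˢ ({x₀}ᶜ : Set E3)) →
    (∀ t < 0, ∀ x, curl (v t) x = cross (gradient (T t) x) (x - x₀)) →
    ∀ t < 0, ∀ x, x ≠ x₀ →
      cross (gradient (fun z => deriv (fun s => T s z) t + inner ℝ (v t z) (gradient (T t) z)
            - Laplacian.laplacian (T t) z) x) (x - x₀) =
        cross (gradient (fun z => inner ℝ (v t z) (z - x₀)) x) (gradient (T t) x)

/-- v2 stub 3 statement (verbatim copy): irrotational bounded slices are constant. -/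
def StubConstantOfIrrotational : Prop :=
  ∀ (v : ℝ → E3 → E3),
    IsBoundedAncientMildSolution 1 v →
    ContDiffOn ℝ (⊤ : ℕ∞) (Function.uncurry v) (Set.Iio 0 ×ˢ Set.univ) →
    (∀ t < 0, ∀ x, curl (v t) x = 0) →
    ∀ t < 0, ∃ b : E3, ∀ x, v t x = b

/-- THE RE-TYPED WALL: v2's `StubScalarLiouville` with the single extra hypothesis `∃ C, HasTypeITimeDecay C v`
(Type-I-in-time decay of the profile — what both consumers supply).  By the far-past collapse this needs only the
one-sided maximum principle (MP) for the line's density η_gen (plus the cheap (D),(N),(Det)), not a two-sided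
Liouville theorem. OPEN; nothing here proves it. -/
def StubScalarLiouvilleTypeI : Prop :=
  ∀ (v : ℝ → E3 → E3) (x₀ : E3) (T : ℝ → E3 → ℝ),
    (∃ C : ℝ, HasTypeITimeDecay C v) →
    IsBoundedAncientMildSolution 1 v →
    (∀ t < 0, AEStronglyMeasurable (v t) volume) →
    ContDiffOn ℝ (⊤ : ℕ∞) (Function.uncurry v) (Set.Iio 0 ×ˢ Set.univ) →
    ContDiffOn ℝ (⊤ : ℕ∞) (Function.uncurry T) (Set.Iio 0 ×ˢ ({x₀}ᶜ : Set E3)) →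
    (∃ C : ℝ, ∀ t < 0, ∀ x, |T t x| ≤ C) →
    (∀ t < 0, ∀ x, curl (v t) x = cross (gradient (T t) x) (x - x₀)) →
    (∀ t < 0, ∀ x, x ≠ x₀ →
      cross (gradient (fun z => deriv (fun s => T s z) t + inner ℝ (v t z) (gradient (T t) z)
            - Laplacian.laplacian (T t) z) x) (x - x₀) =
        cross (gradient (fun z => inner ℝ (v t z) (z - x₀)) x) (gradient (T t) x)) →
    ∀ t < 0, ∀ x, cross (gradient (T t) x) (x - x₀) = 0

/-- KERNEL-CHECKED COMPOSITION (no sorry; the stubs enter as hypotheses): the v2 line with its wall re-typed to the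
Type-I class proves C⁻ = `PoloidalLiouvilleTypeI` — and hence, via `closes_typeI`, route UnthreadedDoor's Target. -/
theorem PoloidalLiouvilleTypeI_of_stubs (h₁ : StubVorticityOfClass) (h₂ : StubToroidalPotential)
    (h₃ : StubPotentialEvolution) (h₄ : StubScalarLiouvilleTypeI) (h₅ : StubConstantOfIrrotational) :
    PoloidalLiouvilleTypeI := by
  intro v hv t ht
  obtain ⟨hC, hB, hm, hsm, x₀, hx₀⟩ := hv
  obtain ⟨hV, K, hK⟩ := h₁ v hB hm hsm
  obtain ⟨T, hT, hTb, hrep⟩ := h₂ v x₀ K hsm hK hx₀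
  have hE := h₃ v x₀ T hV hT hrep
  have h0 := h₄ v x₀ T hC hB hm hsm hT ⟨Real.pi * K, hTb⟩ hrep hE
  have hcurl : ∀ s < 0, ∀ x, curl (v s) x = 0 := fun s hs x => by
    rw [hrep s hs x]
    exact h0 s hs x
  exact h₅ v hB hsm hcurl t ht

/-- End to end: the five v2 stubs with the re-typed wall close the door route. -/
theorem door_of_stubs (h₁ : StubVorticityOfClass) (h₂ : StubToroidalPotential)
    (h₃ : StubPotentialEvolution) (h₄ : StubScalarLiouvilleTypeI) (h₅ : StubConstantOfIrrotational)
    (hZ : UnthreadedDoor.UnthreadedZoom) (hS : UnthreadedDoor.ShiftedPoloidalClass)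
    (hE : UnthreadedDoor.ConstantSliceExtinction) : UnthreadedDoor.Target :=
  closes_typeI hZ hS (PoloidalLiouvilleTypeI_of_stubs h₁ h₂ h₃ h₄ h₅) hE


/-! ### §P1 — prices owed on verdict V50 (idea-crit-9 / ns-wall-crit-1): the (D) and (Det) side conditions of the
η_gen schema as SIGNATURES (v3, planner ns-idea-14 g2).  Nothing here is proved; (MP) for η_gen stays the open input and is
now SUPERSEDED as this seat's recommended line by the net-flux law of `Cruxes/PoloidalLiouville/NetFluxTransportSketch.lean`
(crux idea «netflux-typei-gap»), which needs neither (MP) nor η_gen. -/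

/-- Loop period `P(x) = ∮_{Γ_x} dℓ/|ω|` of the level loop `Γ_x` of `T|_{S_{|x−x₀|}(x₀)}` through `x` (the connected
component through `x` of the level set on the sphere; `μH¹` = 1-dimensional Hausdorff measure; value `⊤` allowed). -/
noncomputable def loopPeriod (ω : E3 → E3) (T : E3 → ℝ) (x₀ x : E3) : ENNReal :=
  ∫⁻ y in connectedComponentIn {y : E3 | dist y x₀ = dist x x₀ ∧ T y = T x} x,
    ENNReal.ofReal (‖ω y‖⁻¹) ∂(MeasureTheory.Measure.hausdorffMeasure 1)

/-- `η_gen(x) = 2π / P(x)` — the (2b) line's density (= KNSS's `η = ω_φ/ρ` in the axisymmetric case); junk-safe: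
`= 0` when the period is infinite (loop through a critical point of `T|_{S_r}`). -/
noncomputable def etaGen (ω : E3 → E3) (T : E3 → ℝ) (x₀ x : E3) : ℝ :=
  2 * Real.pi / (loopPeriod ω T x₀ x).toReal

/-- **(D) = `EtaGenSliceBound` (support, S).**  Universal slice bound `η_gen ≤ c (‖∇ω‖_∞ + ‖ω‖_∞ / |x − x₀|)`:
`P ≥ L / max_Γ|ω|` and the smaller cap bounded by `Γ` (length `L`) contains a critical point of `T|_{S_r}` where
`|ω| = r|∇_S T|` vanishes, `diam ≤ c·L`.  With KNSS smoothing this makes (D) (far-past decay of `sup η_gen`) automatic in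
the Type-I class.  Why it might fail: the cap–diameter constant near hemispherical loops (`L ≈ πr`) is where the
`‖ω‖_∞/|x−x₀|` term is needed; stated with it. -/
def EtaGenSliceBound : Prop :=
  ∃ c : ℝ, 0 < c ∧ ∀ (v : E3 → E3) (x₀ : E3) (T : E3 → ℝ) (K₀ K₁ : ℝ),
    ContDiff ℝ 2 v → ContDiffOn ℝ 2 T ({x₀}ᶜ : Set E3) →
    (∀ x, curl v x = cross (gradient T x) (x - x₀)) →
    (∀ x, ‖curl v x‖ ≤ K₀) → (∀ x, ‖fderiv ℝ (curl v) x‖ ≤ K₁) →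
    ∀ x, x ≠ x₀ → etaGen (curl v) T x₀ x ≤ c * (K₁ + K₀ / ‖x - x₀‖)

/-- **(Det-a) = `DetSard` (support, S).**  A non-constant `C²` function on a sphere attains a REGULAR value: some level
set of `T|_{S_r(x₀)}` is non-empty and free of critical points (Sard on `S²` for `C²` maps to `ℝ` + the range is an
interval).  `cross (gradient T y) (y − x₀) ≠ 0 ⇔ ∇_{S}T(y) ≠ 0`. -/
def DetSard : Prop :=
  ∀ (T : E3 → ℝ) (x₀ : E3) (r : ℝ), 0 < r → ContDiffOn ℝ 2 T ({x₀}ᶜ : Set E3) →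
    (¬ ∃ a : ℝ, ∀ x ∈ Metric.sphere x₀ r, T x = a) →
    ∃ x ∈ Metric.sphere x₀ r, ∀ y ∈ Metric.sphere x₀ r, T y = T x → cross (gradient T y) (y - x₀) ≠ 0

/-- **(Det-b) = `EtaGenDetects` (support, S).**  If `η_gen ≡ 0` on a sphere then `T` is constant on it: on the regular
level loop given by `DetSard`, `|ω| = r|∇_S T| > 0` is bounded below and the loop is a compact `C¹` curve, so the period is
finite and `η_gen > 0` there — contradiction.  Feeds the landed `StubConstantOfIrrotational` exactly as in the card. -/
def EtaGenDetects : Prop :=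
  ∀ (v : E3 → E3) (x₀ : E3) (T : E3 → ℝ) (r : ℝ), 0 < r →
    ContDiff ℝ 2 v → ContDiffOn ℝ 2 T ({x₀}ᶜ : Set E3) →
    (∀ x, curl v x = cross (gradient T x) (x - x₀)) →
    (∀ x ∈ Metric.sphere x₀ r, etaGen (curl v) T x₀ x = 0) →
    ∃ a : ℝ, ∀ x ∈ Metric.sphere x₀ r, T x = a

end Summit.NavierStokesRegularity.NavierStokesRegularity.Cruxes.PoloidalLiouville.FarPastCollapse
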